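import Summits.Ventures.Crystal3D.Bulk.HullSubmapConvex
import Summits.Ventures.Crystal3D.Bulk.GapHullConnected
import HarnessLib

/-!
# Ears exist: in a connected sub-map of the hull fan covering every vertex, some face of period
# `≥ 4` (if any) has an ear — by counting fan triangles (route 1 of `HOME/lean/lemmaL/DESIGN.md`,
# step R1.6, WITHOUT the regions layer)

HONEST FRAMING. Part of the venture `Summits/Ventures/Crystal3D` (cell `pub-crystal3d`, phase 2;
seat p3), generic and configuration-free; nothing here mentions GAP(1.26). This discharges the
hypothesis `EarsUp` of the ear induction `Bulk/HullSubmapConvex.lean` for every `α`-closed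
`S ⊆ hullDarts X` that COVERS `X` (every point of `X` is the tail of a dart of `S` — no vertex can
be interior to a face) and is CONNECTED (`numK = 1`), by a global count instead of a per-face
region argument:

* to each dart `x` attach the fan triangle `faceTri X x` on its right; darts with the same
  triangle lie on the same face of `S` and exhibit an EAR there (p3 g6's
  `eq_or_eq_or_eq_of_faceTri_eq`: the fibre of `faceTri` is one `φ_H`-orbit);
* if no face of period `≥ 4` had an ear, `faceTri` would be injective on the darts of the long
  faces, with image disjoint from the triangles of the short faces (period `≤ 3`), whose darts
  number at most `3 ×` their faces; with Euler for `S` (`2N − #S + 2F = 4`, planarity of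
  sub-maps, typer-bulk-2's `chi2_eq_of_subset`, `V = N` by covering, `K = 1`) and Legendre's
  `#fanTriSets = 2N − 4` this forces the number of long faces to be `0`.

Main results: `HullRotSys.exists_ear_of_cover` and **`HullRotSys.earsUp_of_cover`**
(`EarsUp S` for covering connected `S`), hence **`HullRotSys.faceConvex_of_cover`**: every face
walk of a covering, connected, `α`-closed sub-map with all corners `< π` is convex.
-/

noncomputable section

namespace Summit.Ventures.Crystal3D

namespace HullRotSys

open Literature.Geometry.DiscreteGeometry Finset Equiv Real Function
open scoped Classical

variable {X : Finset (EuclideanSpace ℝ (Fin 3))} {hX1 : ∀ y ∈ X, ‖y‖ = 1}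
  {h0 : (0 : EuclideanSpace ℝ (Fin 3)) ∈ interior (convexHull ℝ (X : Set _))}

/-! ## Faces as finsets: size = period -/

/-- The face of `x` (p3 g7's `RotSys.face`) is the set of darts of its walk. -/
theorem face_eq_image_range {S : Finset ↥(hullDarts X)} (hS : RotSys.IsClosed (inv X) S)
    {x : ↥(hullDarts X)} (hx : x ∈ S) :
    RotSys.face (rot hX1 h0) (inv X) S x =
      (range (facePeriod hX1 h0 S x)).image (faceDart hX1 h0 S x) := by
  ext y
  rw [RotSys.mem_face, mem_image]
  constructor
  · rintro ⟨-, hc⟩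
    obtain ⟨k, hk, hky⟩ := RotSys.SameCycle.exists_lt_minimalPeriod hc
    exact ⟨k, mem_range.2 hk, hky⟩
  · rintro ⟨k, -, rfl⟩
    exact ⟨faceDart_mem hS hx k, ⟨(k : ℤ), by rw [zpow_natCast]; rfl⟩⟩

/-- **The number of darts of a face is its period.** -/
theorem card_face_eq_facePeriod {S : Finset ↥(hullDarts X)} (hS : RotSys.IsClosed (inv X) S)
    {x : ↥(hullDarts X)} (hx : x ∈ S) :
    (RotSys.face (rot hX1 h0) (inv X) S x).card = facePeriod hX1 h0 S x := by
  rw [face_eq_image_range hS hx, card_image_of_injOn, card_range]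
  intro i hi j hj h
  exact RotSys.pow_apply_injOn _ x (mem_range.1 hi) (mem_range.1 hj) h

/-- Darts on a common face have the same period. -/
theorem facePeriod_eq_of_sameCycle {S : Finset ↥(hullDarts X)} {x y : ↥(hullDarts X)}
    (h : (RotSys.phi (rot hX1 h0) (inv X) S).SameCycle x y) :
    facePeriod hX1 h0 S y = facePeriod hX1 h0 S x := by
  obtain ⟨k, -, rfl⟩ := RotSys.SameCycle.exists_lt_minimalPeriod h
  exact facePeriod_shift S x k

/-! ## The fan triangle on the right of a dart; collisions are ears -/

/-- The ambient face successor `φ_H x = σ_H (α x)` as a hull dart. -/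
theorem phi_univ_eq (x : ↥(hullDarts X)) :
    RotSys.phi (rot hX1 h0) (inv X) univ x = rot hX1 h0 (inv X x) := by
  rw [RotSys.phi_apply, induce_univ_apply]

/-- If the ambient successor of `x ∈ S` is in `S`, it IS the face successor (an ear at `x`). -/
theorem phi_eq_rot_inv_of_mem {S : Finset ↥(hullDarts X)} (hS : RotSys.IsClosed (inv X) S)
    {x : ↥(hullDarts X)} (hx : x ∈ S) (hmem : rot hX1 h0 (inv X x) ∈ S) :
    RotSys.phi (rot hX1 h0) (inv X) S x = rot hX1 h0 (inv X x) := by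
  rw [RotSys.phi_apply]
  exact RotSys.induce_eq_of_first_return _ (hS _ hx) Nat.one_pos (by rw [pow_one]) hmem
    (fun m hm0 hm1 => absurd hm1 (by omega))

/-- **Collision ⇒ ear.** Two distinct darts of `S` with the same right-hand fan triangle lie on
one face of `S`, which has an ear. -/
theorem exists_ear_of_faceTri_eq {S : Finset ↥(hullDarts X)} (hS : RotSys.IsClosed (inv X) S)
    {x x' : ↥(hullDarts X)} (hx : x ∈ S) (hx' : x' ∈ S) (hne : x' ≠ x)
    (h : faceTri X x'.1 = faceTri X x.1) :
    ∃ y ∈ S, RotSys.phi (rot hX1 h0) (inv X) S y = rot hX1 h0 (inv X y) ∧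
      (RotSys.phi (rot hX1 h0) (inv X) S).SameCycle y x ∧
      (RotSys.phi (rot hX1 h0) (inv X) S).SameCycle y x' := by
  have hΦ : ∀ z : ↥(hullDarts X), (rot hX1 h0 (inv X z)).1 = hullFace X z.1 := by
    intro z; rw [← phi_univ_eq, phi_univ_apply]
  rcases eq_or_eq_or_eq_of_faceTri_eq hX1 h0 x.2 x'.2 h with h1 | h2 | h3
  · exact absurd (Subtype.ext h1) hne
  · -- `x' = φ_H x`: ear at `x`
    have hx'e : x' = rot hX1 h0 (inv X x) := Subtype.ext (by rw [hΦ]; exact h2)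
    have hear := phi_eq_rot_inv_of_mem hS hx (hx'e ▸ hx')
    refine ⟨x, hx, hear, Perm.SameCycle.refl _ _, ⟨1, ?_⟩⟩
    rw [zpow_one, hear, hx'e]
  · -- `x' = φ_H² x`: then `φ_H x' = x`, ear at `x'`
    have hx'e : x' = rot hX1 h0 (inv X (rot hX1 h0 (inv X x))) :=
      Subtype.ext (by rw [hΦ, hΦ]; exact h3)
    have hnext : rot hX1 h0 (inv X x') = x := by rw [hx'e]; exact rot_inv_rot_inv_rot_inv x
    have hear := phi_eq_rot_inv_of_mem hS hx' (hnext.symm ▸ hx)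
    refine ⟨x', hx', hear, ⟨1, ?_⟩, Perm.SameCycle.refl _ _⟩
    rw [zpow_one, hear, hnext]

include hX1 h0 in
/-- The fibre of `faceTri` through a dart has at most three darts. -/
theorem card_filter_faceTri_le_three (T : Finset ↥(hullDarts X)) (t : Finset (EuclideanSpace ℝ (Fin 3))) :
    (T.filter fun x => faceTri X x.1 = t).card ≤ 3 := by
  by_cases hne : (T.filter fun x => faceTri X x.1 = t).Nonempty
  · obtain ⟨x, hx⟩ := hne
    have hxt : faceTri X x.1 = t := (mem_filter.1 hx).2
    set Φ := fun z : ↥(hullDarts X) => rot hX1 h0 (inv X z)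
    have hsub : (T.filter fun x => faceTri X x.1 = t) ⊆ {x, Φ x, Φ (Φ x)} := by
      intro y hy
      have hyt : faceTri X y.1 = faceTri X x.1 := by rw [(mem_filter.1 hy).2, hxt]
      have hΦ : ∀ z : ↥(hullDarts X), (Φ z).1 = hullFace X z.1 := by
        intro z; show (rot hX1 h0 (inv X z)).1 = _; rw [← phi_univ_eq, phi_univ_apply]
      rw [mem_insert, mem_insert, mem_singleton]
      rcases eq_or_eq_or_eq_of_faceTri_eq hX1 h0 x.2 y.2 hyt with h1 | h2 | h3
      · exact Or.inl (Subtype.ext h1)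
      · exact Or.inr (Or.inl (Subtype.ext (by rw [hΦ]; exact h2)))
      · exact Or.inr (Or.inr (Subtype.ext (by rw [hΦ, hΦ]; exact h3)))
    exact (card_le_card hsub).trans (card_le_three)
  · rw [not_nonempty_iff_eq_empty.1 hne, card_empty]; omega

/-! ## The counts -/

/-- `F = #faces` as a finset count. -/
theorem numF_eq_card_image_face (S : Finset ↥(hullDarts X)) :
    RotSys.numF (rot hX1 h0) (inv X) S = (S.image (RotSys.face (rot hX1 h0) (inv X) S)).card := by
  unfold RotSys.numF
  refine numClasses_eq_card_image _ fun x hx y hy => ⟨fun h => RotSys.face_eq_of_sameCycle h, fun h => ?_⟩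
  have : y ∈ RotSys.face (rot hX1 h0) (inv X) S x := by rw [h]; exact RotSys.mem_face_self hy
  exact (RotSys.mem_face.1 this).2

/-- `V = #X` for a covering `S`. -/
theorem numV_eq_card_of_cover {S : Finset ↥(hullDarts X)}
    (hcov : ∀ y ∈ X, ∃ z ∈ S, z.1.1 = y) : RotSys.numV (rot hX1 h0) S = X.card := by
  unfold RotSys.numV
  rw [numClasses_eq_card_image (fun d : ↥(hullDarts X) => d.1.1) (fun d _ d' _ => sameCycle_rot_iff d d')]
  congr 1
  ext y
  rw [mem_image]
  constructor
  · rintro ⟨d, -, rfl⟩; exact fst_mem_of_mem_hullDarts hX1 d.2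
  · intro hy
    obtain ⟨z, hz, hzy⟩ := hcov y hy
    exact ⟨z, hz, hzy⟩

/-- **Euler for a covering connected sub-map**: `2·#X − #S + 2·F = 4`. -/
theorem euler_of_cover {S : Finset ↥(hullDarts X)} (hS : RotSys.IsClosed (inv X) S)
    (hcov : ∀ y ∈ X, ∃ z ∈ S, z.1.1 = y) (hk : RotSys.numK (rot hX1 h0) (inv X) S = 1) :
    2 * (X.card : ℤ) - S.card + 2 * ((S.image (RotSys.face (rot hX1 h0) (inv X) S)).card : ℤ) = 4
      := by
  have hplanar := chi2_univ_eq_numK (hX1 := hX1) (h0 := h0)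
  have h := (isRotSys (hX1 := hX1) (h0 := h0)).chi2_eq_of_subset (fun _ _ => mem_univ _) hS
    (subset_univ _) hplanar
  unfold RotSys.chi2 at h
  rw [numV_eq_card_of_cover hcov, numF_eq_card_image_face, hk] at h
  norm_num at h
  linarith

/-! ## Connectivity and covering pass to super-maps -/

/-- A super-map of a covering connected sub-map is connected. -/
theorem numK_eq_one_of_cover {S S' : Finset ↥(hullDarts X)} (hsub : S ⊆ S')
    (hcov : ∀ y ∈ X, ∃ z ∈ S, z.1.1 = y) (hk : RotSys.numK (rot hX1 h0) (inv X) S = 1) :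
    RotSys.numK (rot hX1 h0) (inv X) S' = 1 := by
  -- any two darts of `S'` are connected in `S'`
  have hconnS : ∀ x ∈ S, ∀ y ∈ S, RotSys.conn (rot hX1 h0) (inv X) S x y :=
    fun x hx y hy => rel_of_numClasses_eq_one (fun z _ => RotSys.conn_refl _ _ _ z) hk hx hy
  have hmono : ∀ x y, RotSys.conn (rot hX1 h0) (inv X) S x y → RotSys.conn (rot hX1 h0) (inv X) S' x y := by
    intro x y h
    refine Relation.EqvGen.mono ?_ x y h
    rintro a b ⟨ha, hb, hab⟩
    exact ⟨hsub ha, hsub hb, hab⟩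
  have hanchor : ∀ x ∈ S', ∃ z ∈ S, RotSys.conn (rot hX1 h0) (inv X) S' x z := by
    intro x hx
    obtain ⟨z, hz, hzx⟩ := hcov x.1.1 (fst_mem_of_mem_hullDarts hX1 x.2)
    refine ⟨z, hz, RotSys.conn_of_sameCycle hx (hsub hz) ?_⟩
    rw [sameCycle_rot_iff]; exact hzx.symm
  have hall : ∀ x ∈ S', ∀ y ∈ S', RotSys.conn (rot hX1 h0) (inv X) S' x y := by
    intro x hx y hy
    obtain ⟨z, hz, hxz⟩ := hanchor x hx
    obtain ⟨z', hz', hyz⟩ := hanchor y hy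
    exact RotSys.conn_trans (RotSys.conn_trans hxz (hmono _ _ (hconnS z hz z' hz')))
      (RotSys.conn_symm hyz)
  have hne : S'.Nonempty := by
    have hSne : S.Nonempty := by
      by_contra hem
      rw [not_nonempty_iff_eq_empty] at hem
      rw [hem, RotSys.numK_empty] at hk
      exact zero_ne_one hk
    exact hSne.mono hsub
  unfold RotSys.numK
  rw [numClasses_eq_card_image (fun _ : ↥(hullDarts X) => (0 : ℕ))
    (fun d hd d' hd' => iff_of_true (hall d hd d' hd') rfl), image_const hne, card_singleton]

/-! ## The ear count -/

/-- **Some long face has an ear.** For an `α`-closed, covering, connected `S ⊆ hullDarts X` with a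
face of period `≥ 4`, some dart `e` on a face of period `≥ 4` has `φ_S e = σ_H (α e)`. -/
theorem exists_ear_of_cover {S : Finset ↥(hullDarts X)} (hS : RotSys.IsClosed (inv X) S)
    (hcov : ∀ y ∈ X, ∃ z ∈ S, z.1.1 = y) (hk : RotSys.numK (rot hX1 h0) (inv X) S = 1)
    (hlong : ∃ d ∈ S, 4 ≤ facePeriod hX1 h0 S d) :
    ∃ e ∈ S, 4 ≤ facePeriod hX1 h0 S e ∧
      RotSys.phi (rot hX1 h0) (inv X) S e = rot hX1 h0 (inv X e) := by
  by_contra H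
  push Not at H
  set φ := RotSys.phi (rot hX1 h0) (inv X) S with hφ
  set Tm : ↥(hullDarts X) → Finset (EuclideanSpace ℝ (Fin 3)) := fun x => faceTri X x.1 with hTm
  set fc := RotSys.face (rot hX1 h0) (inv X) S with hfc
  set L := S.filter (fun x => 4 ≤ facePeriod hX1 h0 S x) with hL
  set K := S.filter (fun x => facePeriod hX1 h0 S x ≤ 3) with hK
  have hLS : L ⊆ S := filter_subset _ _
  have hKS : K ⊆ S := filter_subset _ _
  have hLK : Disjoint L K := by
    rw [hL, hK, disjoint_filter]; intro x _ h1 h2; omega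
  have hSLK : S = L ∪ K := by
    ext x; rw [hL, hK, mem_union, mem_filter, mem_filter]
    constructor
    · intro hx; by_cases h4 : 4 ≤ facePeriod hX1 h0 S x
      · exact Or.inl ⟨hx, h4⟩
      · exact Or.inr ⟨hx, by omega⟩
    · rintro (⟨hx, -⟩ | ⟨hx, -⟩) <;> exact hx
  have hcardS : S.card = L.card + K.card := by rw [hSLK, card_union_of_disjoint hLK]
  -- a collision inside `S` between darts one of which is long gives a forbidden ear
  have hnocoll : ∀ x ∈ L, ∀ x' ∈ S, x' ≠ x → Tm x' ≠ Tm x := by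
    intro x hx x' hx' hne heq
    obtain ⟨hxS, hx4⟩ := mem_filter.1 hx
    obtain ⟨y, hy, hear, hyx, -⟩ := exists_ear_of_faceTri_eq hS hxS hx' hne heq
    have hPy : facePeriod hX1 h0 S x = facePeriod hX1 h0 S y := facePeriod_eq_of_sameCycle hyx
    exact H y hy (by rw [← hPy]; exact hx4) hear
  -- (a) `Tm` is injective on `L`
  have hinj : Set.InjOn Tm L := by
    intro x hx x' hx' h
    by_contra hne
    exact hnocoll x hx x' (hLS hx') (Ne.symm hne) h.symm
  -- (b) images of `L` and `K` are disjoint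
  have hdisj : Disjoint (L.image Tm) (K.image Tm) := by
    rw [disjoint_left]
    intro t ht ht'
    obtain ⟨x, hx, rfl⟩ := mem_image.1 ht
    obtain ⟨x', hx', h⟩ := mem_image.1 ht'
    have hne : x' ≠ x := by
      intro heq; rw [heq] at hx'
      have h1 := (mem_filter.1 hx).2; have h2 := (mem_filter.1 hx').2; omega
    exact hnocoll x hx x' (hKS hx') hne h
  -- (c) `#K ≤ 3 · #(K.image Tm)`
  have hKfib : K.card ≤ 3 * (K.image Tm).card :=
    card_le_mul_card_image K 3 fun t _ => card_filter_faceTri_le_three (hX1 := hX1) (h0 := h0) K t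
  -- (d) the triangles are fan triangles: `#(S.image Tm) ≤ 2N − 4`
  have hfan : (S.image Tm).card ≤ (fanTriSets X).card := by
    refine card_le_card fun t ht => ?_
    obtain ⟨x, -, rfl⟩ := mem_image.1 ht
    exact faceTri_mem_fanTriSets hX1 h0 x.2
  have hleg := card_fanTriSets_add_four hX1 h0
  -- (e) `#(S.image Tm) = #L + #(K.image Tm)`
  have himg : (S.image Tm).card = L.card + (K.image Tm).card := by
    rw [hSLK, image_union, card_union_of_disjoint hdisj, card_image_of_injOn hinj]
  -- (f) faces: `q = q_L + q_K`
  have hfaces : (S.image fc).card = (L.image fc).card + (K.image fc).card := by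
    rw [hSLK, image_union, card_union_of_disjoint]
    rw [disjoint_left]
    intro F hF hF'
    obtain ⟨x, hx, rfl⟩ := mem_image.1 hF
    obtain ⟨x', hx', h⟩ := mem_image.1 hF'
    have hsc : φ.SameCycle x x' := by
      have : x' ∈ fc x := by rw [← h]; exact RotSys.mem_face_self (hKS hx')
      exact (RotSys.mem_face.1 this).2
    have := facePeriod_eq_of_sameCycle hsc
    have h1 := (mem_filter.1 hx).2; have h2 := (mem_filter.1 hx').2
    rw [this] at h2; omega
  -- (g) short faces have `≤ 3` darts: `#K ≤ 3 · q_K`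
  have hKfaces : K.card ≤ 3 * (K.image fc).card := by
    refine card_le_mul_card_image K 3 fun F hF => ?_
    obtain ⟨x, hx, rfl⟩ := mem_image.1 hF
    obtain ⟨hxS, hx3⟩ := mem_filter.1 hx
    calc (K.filter fun a => fc a = fc x).card ≤ (fc x).card := by
          refine card_le_card fun a ha => ?_
          obtain ⟨-, hfa⟩ := mem_filter.1 ha
          rw [← hfa]; exact RotSys.mem_face_self (hKS (mem_filter.1 ha).1)
      _ = facePeriod hX1 h0 S x := card_face_eq_facePeriod hS hxS
      _ ≤ 3 := hx3
  -- (h) Euler, and there IS a long face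
  have heul := euler_of_cover hS hcov hk
  rw [← hfc] at heul
  have hLpos : 0 < (L.image fc).card := by
    obtain ⟨d, hd, hd4⟩ := hlong
    exact card_pos.2 ⟨fc d, mem_image_of_mem _ (mem_filter.2 ⟨hd, hd4⟩)⟩
  -- long faces have `≥ 4` darts: `4 · q_L ≤ #L` (not even needed: `q_L ≥ 1` suffices with the rest)
  -- combine
  have e1 : (S.image Tm).card + 4 ≤ 2 * X.card := by omega
  omega

/-- **`EarsUp` for covering connected sub-maps.** -/
theorem earsUp_of_cover {S : Finset ↥(hullDarts X)}
    (hcov : ∀ y ∈ X, ∃ z ∈ S, z.1.1 = y) (hk : RotSys.numK (rot hX1 h0) (inv X) S = 1) :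
    EarsUp hX1 h0 S := by
  intro S' hsub hS'c _ hlong
  exact exists_ear_of_cover hS'c (fun y hy => by
    obtain ⟨z, hz, hzy⟩ := hcov y hy; exact ⟨z, hsub hz, hzy⟩) (numK_eq_one_of_cover hsub hcov hk)
    hlong

/-- **LEMMA L, generic form.** Every face walk of an `α`-closed, covering, connected sub-map of
the hull fan all of whose corners are `< π` is a convex spherical polygon (walk orientation). -/
theorem faceConvex_of_cover {S : Finset ↥(hullDarts X)} (hS : RotSys.IsClosed (inv X) S)
    (hcov : ∀ y ∈ X, ∃ z ∈ S, z.1.1 = y) (hk : RotSys.numK (rot hX1 h0) (inv X) S = 1)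
    (hlt : ∀ z ∈ S, RotSys.cornerAt (rot hX1 h0) (dartWeight X) S z < π)
    {d : ↥(hullDarts X)} (hd : d ∈ S) : FaceConvex hX1 h0 S d :=
  faceConvex_of_corners_lt_pi _ S rfl hS hlt (earsUp_of_cover hcov hk) d hd

end HullRotSys

end Summit.Ventures.Crystal3D
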